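import Summits.HodgeConjecture.HodgeConjecture.Theorems.ThreefoldSquareKunnethShifts
import Summits.HodgeConjecture.HodgeConjecture.Theorems.Ring2HypothesesDescentLefschetzBAlgebraicDegrees
import Literature.AlgebraicGeometry.HodgeTheory.ComplexOrientationFamily
import Literature.AlgebraicGeometry.HodgeTheory.AlgebraicClassesGysinOneSpan
import Literature.AlgebraicGeometry.HodgeTheory.GysinFormalismHodgeOfGysin
import Literature.AlgebraicGeometry.HodgeTheory.FivefoldChowZeroDegenerateHodgeConjecture
import Literature.AlgebraicTopology.SingularHomology.FiltrationLefschetzCupGeneration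
import Literature.AlgebraicGeometry.Tankeev2011.LefschetzStandardThreefoldsKodairaDimLtThree
import HarnessLib

/-!
# The weight-two Künneth slot `E₂(X)` of the square of a threefold DESCENDS to a surface section, and the rational
# `(2,2)`-classes of `X × X` are decided in dimension four (cell `hodge-nonav`, sector SQ3, rows RED / SQ4 / SQ9–SQ10)

PROVENANCE. Cell hodge-nonav (HUMAN RULING D-0038), planner seat p1 g22: memo `HOME/memos/ROUTE-P1U.md`, frozen sketch
`HOME/memos/ROUTE-P1U-Sketch.lean` (sha16 a80c611254891848, 821 lines, namespace `HodgeNonAV.P1U`, §2, §4–§6; farm rc 0 / 0 sorries,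
re-elaborated 2026-08-28), landed by the prover seat `hodge-nonav-20241-p1` (g10) on the planner's assignment T2 (p1 g35, STATUS
2026-08-28T05:21:56Z) with `--supports stmt-HodgeConjecture-19654 --as helper`. DEF-FREE rendering as in
`Theorems/ThreefoldSquareKunnethShifts` (part 1): the sketch's Prop-valued abbreviations are file-local NOTATION expanding to their
bodies (`RHShift`, `E2`, `ES`, `OddShifts`, `W1Retr`, `HC22C`, `SQ3Conv`), the class `σ = i_* 1_S` of a surface `i : S ⟶ X` is the
notation `SecCl[hS, hX, i]` for the Gysin image of `1`, and `HC22×C` is spelled symbol for symbol as the body of the tree's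
`ThreefoldTimesCurve.HC22TimesCurve` (not imported, to stay out of the `SecondaryPeriods` route cone). Proof bodies verbatim.

THE MECHANISM (§2, KERNEL). Let `X` be a smooth projective threefold, `i : S ⟶ X` a morphism from a smooth projective surface,
`i_* : H²(S) → H⁴(X)` its Gysin map, `i^* : H²(X) → H²(S)` its pull-back, and `Λ : H⁴(X) → H²(X)` ANY algebraic correspondence with
`Λ ∘ i_* ∘ i^* = id` and `i_* ∘ i^* ∘ Λ = id`. Then every rational Hodge morphism `φ : H⁴(X) → H²(X)` of bidegree `(−1,−1)` satisfies
`φ = Λ ∘ i_* ∘ ψ ∘ i^* ∘ Λ` with `ψ := i^* ∘ φ ∘ i_* ∈ End_Hdg(H²(S))` (RED). Hence `E₂(X) ⟸ E(S)` ("every rational Hodge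
endomorphism of `H²(S)` is algebraic").
THE INPUT `Λ` (§3, KERNEL). When `σ := i_* 1_S` is a polarisation class, the projection formula gives `i_* i^* = L_σ` on `H²(X)` and
André's `⋆_L : H⁴ → H²` inverts it on both sides; it is algebraic by `B⋆(X)[σ]` (`StandardConjectureBStar 3 X σ`). So
`E₂(X) ⟸ B⋆(X)[σ] ∧ E(S)`, `E(S) ⟸ HC⁴(S × S)_{(2,2)}` (§1); and the reduction is EXACT (`weightTwoEnd_corner_of_weightTwoShift`).
THE MASTER REDUCTION (§4, KERNEL given the typed rows): with the Künneth-projector converse `SQ3Conv` (Kleiman: algebraic Künneth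
projectors under `B`, PRINT-IMPLIED, typed — not proved), `W1Retr` (PRINT, typed) and `HC22C`:
`HC22sq(X) ⟸ SQ3Conv ∧ B⋆(X) ∧ E(S) ∧ W1Retr[X] ∧ HC22C[X]` — the rational `(2,2)`-classes of the SIXFOLD `X × X` are decided by
`B(X)` and Hodge `(2,2)`-classes on the FOURFOLDS `S × S`, `X × C`, `C × X`; `HC22C[X] ⟸` `CH₀(X × C)`, `CH₀(C × X)` supported in
dimension `≤ 3` (tree Bloch–Srinivas), and `B⋆(X)` off general type is Tankeev's named fact.

HONEST SCOPE. Reductions and structure theorems (the typed rows `SQ3Conv`, `W1Retr` are hypotheses, not facts of the tree); nothing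
here proves the Hodge conjecture for a new variety; rung F-H1 not moved.

## References

* [VoisinHodgeI2002] C. Voisin, Hodge Theory and Complex Algebraic Geometry I (2002), §7.3.2, Thm. 6.25, §11.3.3 Lemma 11.41.
* [VoisinHodgeII2003] C. Voisin, Hodge Theory and Complex Algebraic Geometry II (2003), Prop. 9.20–9.21, Prop. 10.26.
* [Andre1996Motifs] Y. André, Pour une théorie inconditionnelle des motifs (1996), §0.2, §1.1, §2.1.
* [Kleiman1968AlgebraicCycles] S. Kleiman, Algebraic cycles and the Weil conjectures (1968), §2 Thm. 2A11.
* [FultonYoungTableaux1997] W. Fulton, Young Tableaux (1997), App. B §B.1 (5)–(6).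
* [BlochSrinivas1983] S. Bloch, V. Srinivas, Remarks on correspondences and algebraic cycles (1983), Thm. 1 (3).
* [Tankeev2011] S. Tankeev, Izv. Math. 75 (2011), main theorem.
-/

set_option linter.dupNamespace false

noncomputable section

open CategoryTheory AlgebraicGeometry MonoidalCategory CartesianMonoidalCategory
open Literature.AlgebraicTopology.SingularHomology
open Literature.AlgebraicGeometry Literature.AlgebraicGeometry.Motives Literature.AlgebraicGeometry.HodgeTheory
open Literature.Geometry.Kaehler
open Literature.Barriers.HodgeConjecture
open Literature.AlgebraicGeometry.Tankeev2011
open Summit.HodgeConjecture.HodgeConjecture.Theorems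
open Summit.HodgeConjecture.HodgeConjecture.Ring2.AbelianAll

namespace Summit.HodgeConjecture.HodgeConjecture.Theorems.ThreefoldSquare

/-- `RHShift[m, n, Y, X, a, b, e, φ]`: `φ : Hᵃ(X) → Hᵇ(Y)` is the complexification of a morphism of RATIONAL Hodge structures of
bidegree `(e − n, e − n)` (as in `Theorems/ThreefoldSquareKunnethShifts`). Local notation only. -/
local notation3 (prettyPrint := false) "RHShift[" m ", " n ", " Y ", " X ", " a ", " b ", " e ", " φ "]" =>
  ((∀ c, IsRationalClass c → IsRationalClass (φ c)) ∧
  (∀ (p q : ℕ), p + q = a → ∀ c, IsOfHodgeType n X a p q c →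
      ∀ (p' q' : ℕ), p' + n = p + e → q' + n = q + e → IsOfHodgeType m Y b p' q' (φ c)) ∧
  (∀ (p q : ℕ), p + q = a → ∀ c, IsOfHodgeType n X a p q c → (p + e < n ∨ q + e < n) → φ c = 0))

/-- `E2[X]`: the Künneth slot `(2,2)` — every rational Hodge morphism `H⁴(X) → H²(X)` of bidegree `(−1,−1)` is an algebraic
self-correspondence of `X` (verbatim the sketch's `WeightTwoShiftAlgebraic`). Local notation only. -/
local notation3 (prettyPrint := false) "E2[" X "]" =>
  (∀ φ : complexBetti X (2 * 2) →ₗ[ℂ] complexBetti X (2 * 1),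
    RHShift[3, 3, X, X, 2 * 2, 2 * 1, 2, φ] → IsAlgebraicCorrespondence 3 3 X X φ)

/-- `ES[S]`: every rational Hodge ENDOMORPHISM of `H²(S)` of the smooth projective surface `S` is an algebraic self-correspondence
(verbatim the sketch's `WeightTwoEndAlgebraic`; contains `End(NS(S))`, says `End_Hdg(T²(S))` is algebraic). Local notation only. -/
local notation3 (prettyPrint := false) "ES[" S "]" =>
  (∀ ψ : complexBetti S (2 * 1) →ₗ[ℂ] complexBetti S (2 * 1),
    RHShift[2, 2, S, S, 2 * 1, 2 * 1, 2, ψ] → IsAlgebraicCorrespondence 2 2 S S ψ)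

/-- `OddShifts[X]`: the Künneth slots `(1,3)`, `(3,1)` (verbatim the sketch's `OddShiftAlgebraic`). Local notation only. -/
local notation3 (prettyPrint := false) "OddShifts[" X "]" =>
  ((∀ φ : complexBetti X 5 →ₗ[ℂ] complexBetti X 3,
    RHShift[3, 3, X, X, 5, 3, 2, φ] → IsAlgebraicCorrespondence 3 3 X X φ) ∧
  (∀ φ : complexBetti X 3 →ₗ[ℂ] complexBetti X 1,
    RHShift[3, 3, X, X, 3, 1, 2, φ] → IsAlgebraicCorrespondence 3 3 X X φ))

/-- `W1Retr[X]`: the classical weight-one curve retractions (verbatim the sketch's `WeightOneCurveRetractions`). Local notation only. -/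
local notation3 (prettyPrint := false) "W1Retr[" X "]" =>
  (∃ (C : SchemeOver ℂ) (_ : IsSmoothProjective 1 C)
    (u : complexBetti X 5 →ₗ[ℂ] complexBetti C 1) (v : complexBetti C 1 →ₗ[ℂ] complexBetti X 5)
    (u' : complexBetti X 1 →ₗ[ℂ] complexBetti C 1) (v' : complexBetti C 1 →ₗ[ℂ] complexBetti X 1),
    IsAlgebraicCorrespondence 1 3 C X u ∧ RHShift[3, 1, X, C, 1, 5, 3, v] ∧ v ∘ₗ u = LinearMap.id ∧
    IsAlgebraicCorrespondence 3 1 X C v' ∧ RHShift[1, 3, C, X, 1, 1, 3, u'] ∧ v' ∘ₗ u' = LinearMap.id)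

/-- `HC22C[X]`: symbol for symbol the body of `ThreefoldTimesCurve.HC22TimesCurve X` (rational `(2,2)`-classes of `X × C`, `C × X`
algebraic for every smooth projective curve `C`). Local notation only. -/
local notation3 (prettyPrint := false) "HC22C[" X "]" =>
  (∀ ⦃C : SchemeOver ℂ⦄, IsSmoothProjective 1 C →
    (∀ c : complexBetti (X ⊗ C) (2 * 2), IsRationalClass c →
        IsOfHodgeType (3 + 1) (X ⊗ C) (2 * 2) 2 2 c → c ∈ algebraicClasses (X ⊗ C) 2) ∧
      (∀ c : complexBetti (C ⊗ X) (2 * 2), IsRationalClass c →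
        IsOfHodgeType (1 + 3) (C ⊗ X) (2 * 2) 2 2 c → c ∈ algebraicClasses (C ⊗ X) 2))

/-- `HC22sq[X]`: the rational `(2,2)`-classes of `X × X` are algebraic — the body of
`LefschetzStandardShadows.HodgeCodimTwoSquaresOfThreefolds` at `X`. Local notation only. -/
local notation3 (prettyPrint := false) "HC22sq[" X "]" =>
  (∀ c : complexBetti (X ⊗ X) (2 * 2), IsRationalClass c →
    IsOfHodgeType (3 + 3) (X ⊗ X) (2 * 2) 2 2 c → c ∈ algebraicClasses (X ⊗ X) 2)

/-- `SQ3Conv`: the Künneth-projector converse `B⋆(X) ∧ E₂(X) ∧ W₁₃(X) ⟹ HC22sq(X)` for all threefolds (verbatim the sketch's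
`SQ3Converse`; PRINT-IMPLIED by Kleiman 1968 — algebraic Künneth projectors under `B` — typed as a hypothesis, NOT proved here).
Local notation only. -/
local notation3 (prettyPrint := false) "SQ3Conv" =>
  (∀ ⦃X : SchemeOver ℂ⦄, IsSmoothProjective 3 X →
    (∀ η : complexBetti X 2, StandardConjectureBStar 3 X η) → E2[X] → OddShifts[X] → HC22sq[X])

/-- `SecCl[hS, hX, i]`: the class `σ = i_* 1_S ∈ H²(X)` of the surface `i : S ⟶ X` in the threefold (complex orientations;
verbatim the sketch's `sectionClass`). Local notation only. -/
local notation3 (prettyPrint := false) "SecCl[" hS ", " hX ", " i "]" =>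
  complexGysin complexOrientationFamily hS hX i (rfl : 0 + 2 * 3 = 2 + 2 * 2)
    (singularCohomology.one ℂ (ComplexPoints _))

variable {m n d : ℕ} {X Y Z S C : SchemeOver ℂ}

/-! ## §1 `E(S)` from the fourfold `S × S` -/

/-- **`E(S) ⟸` the rational `(2,2)`-classes of the fourfold `S × S` are algebraic** (per-codimension package, `e = 2`).
[cite: VoisinHodgeI2002, §11.3.3 Lemma 11.41] -/
theorem weightTwoEnd_algebraic_of_hodgeTwoTwo_sq (hS : IsSmoothProjective 2 S)
    (halg : ∀ c : complexBetti (S ⊗ S) (2 * 2), IsRationalClass c →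
      IsOfHodgeType (2 + 2) (S ⊗ S) (2 * 2) 2 2 c → c ∈ algebraicClasses (S ⊗ S) 2) : ES[S] := fun φ hφ ↦
  isAlgebraicCorrespondence_of_shift_of_hodgeClasses_prod_algebraic hS hS (a := 2 * 1) (b := 2 * 1)
    (e := 2) (q := 2) (by norm_num) (by norm_num) halg φ hφ

/-- **`E(S)` on the `p_g = 0` locus (KERNEL)**: if `H²(S) = N¹H²(S)` then EVERY linear endomorphism of `H²(S)` is an algebraic
correspondence (`isAlgebraicCorrespondence_of_algebraicClasses_eq_top`). [cite: Kleiman1968AlgebraicCycles, §2] -/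
theorem weightTwoEnd_algebraic_of_algebraicClasses_one_eq_top (hS : IsSmoothProjective 2 S)
    (h₂ : algebraicClasses S 1 = ⊤) : ES[S] := fun ψ _ ↦
  isAlgebraicCorrespondence_of_algebraicClasses_eq_top hS (by norm_num) h₂ ψ

/-! ## §2 THE MECHANISM: `E₂(X)` descends to a surface through any algebraic two-sided inverse `Λ` of `i_* i^*` -/

/-- **RED, abstract form.** `X` a smooth projective threefold, `i : S ⟶ X` from a smooth projective surface, `Λ : H⁴(X) → H²(X)`
an algebraic correspondence with `Λ (i_* i^* x) = x` on `H²(X)` and `i_* i^* (Λ y) = y` on `H⁴(X)`. If every rational Hodge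
endomorphism of `H²(S)` is algebraic (`ES[S]`), then every rational Hodge morphism `φ : H⁴(X) → H²(X)(−1)` is algebraic (`E2[X]`):
`φ = Λ ∘ i_* ∘ (i^* φ i_*) ∘ i^* ∘ Λ`. [cite: Andre1996Motifs, §2.1 (p. 15)] [cite: VoisinHodgeI2002, §7.3.2 and §11.3.3 Lemma 11.41] -/
theorem weightTwoShift_algebraic_of_surface_abstract (hX : IsSmoothProjective 3 X)
    (hS : IsSmoothProjective 2 S) (i : S ⟶ X)
    (Λ : complexBetti X (2 * 2) →ₗ[ℂ] complexBetti X (2 * 1)) (hΛ : IsAlgebraicCorrespondence 3 3 X X Λ)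
    (h₁ : ∀ x : complexBetti X (2 * 1),
      Λ (complexGysin complexOrientationFamily hS hX i (by norm_num : 2 * 1 + 2 * 3 = 2 * 2 + 2 * 2)
        ((complexBetti.map i (2 * 1)).hom x)) = x)
    (h₂ : ∀ y : complexBetti X (2 * 2),
      complexGysin complexOrientationFamily hS hX i (by norm_num : 2 * 1 + 2 * 3 = 2 * 2 + 2 * 2)
        ((complexBetti.map i (2 * 1)).hom (Λ y)) = y)
    (hE : ES[S]) : E2[X] := by
  intro φ hφ
  set gy := complexGysin complexOrientationFamily hS hX i (by norm_num : 2 * 1 + 2 * 3 = 2 * 2 + 2 * 2)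
    with hgy_def
  set pb : complexBetti X (2 * 1) →ₗ[ℂ] complexBetti S (2 * 1) := (complexBetti.map i (2 * 1)).hom
    with hpb_def
  -- the induced endomorphism of `H²(S)`
  set ψ : complexBetti S (2 * 1) →ₗ[ℂ] complexBetti S (2 * 1) := pb ∘ₗ (φ ∘ₗ gy) with hψ_def
  have hgyS : RHShift[3, 2, X, S, 2 * 1, 2 * 2, 3, gy] := rhShift_complexGysin hS hX i _ (by norm_num)
  have hpbS : RHShift[2, 3, S, X, 2 * 1, 2 * 1, 3, pb] := rhShift_map hS hX i (2 * 1)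
  have hψS : RHShift[2, 2, S, S, 2 * 1, 2 * 1, 2, ψ] :=
    rhShift_comp hS (rhShift_comp (E := 2) hX hgyS hφ (by norm_num) (by norm_num)) hpbS (by norm_num) (by norm_num)
  have hψA : IsAlgebraicCorrespondence 2 2 S S ψ := hE ψ hψS
  -- the pieces are algebraic
  have hgyA : IsAlgebraicCorrespondence 3 2 X S gy :=
    isAlgebraicCorrespondence_complexGysin complexOrientationFamily hasPoincareDuality_complexOrientationFamily
      hS hX i _ (q := 2) (by norm_num)
  have hpbA : IsAlgebraicCorrespondence 2 3 S X pb := isAlgebraicCorrespondence_map hS hX i (by norm_num)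
  -- the sandwich identity
  have hsand : φ = Λ ∘ₗ (gy ∘ₗ (ψ ∘ₗ (pb ∘ₗ Λ))) := by
    refine LinearMap.ext fun y ↦ ?_
    simp only [hψ_def, LinearMap.comp_apply]
    rw [h₂ y, h₁ (φ y)]
  rw [hsand]
  refine IsAlgebraicCorrespondence.comp hX hX hX ?_ hΛ (by norm_num)
  refine IsAlgebraicCorrespondence.comp hX hS hX ?_ hgyA (by norm_num)
  refine IsAlgebraicCorrespondence.comp hS hS hX ?_ hψA (by norm_num)
  exact IsAlgebraicCorrespondence.comp hS hX hX hΛ hpbA (by norm_num)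

/-! ## §3 The input `Λ = ⋆_L` from `B⋆(X)` at the class `σ = i_* 1_S` of the surface -/

/-- `σ = i_* 1_S` is a rational class. [cite: VoisinHodgeI2002, §7.3.2 and §11.1.2] -/
theorem isRationalClass_secCl (hS : IsSmoothProjective 2 S) (hX : IsSmoothProjective 3 X) (i : S ⟶ X) :
    IsRationalClass (SecCl[hS, hX, i]) :=
  isRationalClass_complexGysin_complexOrientationFamily hS hX i _ (isRationalClass_one _)

/-- `σ = i_* 1_S ∈ N¹H²(X)` (the class of a divisor). [cite: FultonYoungTableaux1997, Appendix B §B.1 (5) and §B.3] -/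
theorem secCl_mem_algebraicClasses (hS : IsSmoothProjective 2 S) (hX : IsSmoothProjective 3 X) (i : S ⟶ X) :
    SecCl[hS, hX, i] ∈ algebraicClasses X 1 :=
  complexGysin_one_mem_algebraicClasses_codim complexOrientationFamily (p := 1) (d := 2) (by norm_num) hS hX i _

/-- Hence `σ` is a polarisation class iff it has the hard Lefschetz property in dimension `3` — which holds when `S` is a smooth
member of a (very) ample linear system (`σ = c₁(𝒪_X(S))`, Voisin I Thm. 6.25; Bertini). [cite: VoisinHodgeI2002, Thm. 6.25 and Rem. 6.27] -/
theorem isPolarizationClass_secCl (hS : IsSmoothProjective 2 S) (hX : IsSmoothProjective 3 X) (i : S ⟶ X)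
    (hL : HasHardLefschetzProperty (SecCl[hS, hX, i]) 3) : IsPolarizationClass 3 X (SecCl[hS, hX, i]) :=
  ⟨isRationalClass_secCl hS hX i, secCl_mem_algebraicClasses hS hX i, hL⟩

/-- **Projection formula: `i_* i^* x = x ∪ σ`** on `H²(X)`. [cite: FultonYoungTableaux1997, Appendix B §B.1 (6)] -/
theorem gysin_map_eq_cup_secCl (hS : IsSmoothProjective 2 S) (hX : IsSmoothProjective 3 X) (i : S ⟶ X)
    (x : complexBetti X (2 * 1)) :
    complexGysin complexOrientationFamily hS hX i (by norm_num : 2 * 1 + 2 * 3 = 2 * 2 + 2 * 2)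
        ((complexBetti.map i (2 * 1)).hom x) =
      cupProduct (by norm_num : 2 * 1 + 2 = 2 * 2) x (SecCl[hS, hX, i]) := by
  have h := complexGysin_cup hasPoincareDuality_complexOrientationFamily hS hX i (p := 2 * 1) (q := 0)
    (a := 2 * 1) (b := 2 * 2) (q' := 2) rfl (by norm_num) (by norm_num) (by norm_num) x
    (singularCohomology.one ℂ (ComplexPoints S))
  rw [cupProduct_one] at h
  exact h

/-- **`i_* i^* = L_σ` on `H²(X)`** (projection formula and the commutativity of the cup product in degrees `2 + 2`).
[cite: FultonYoungTableaux1997, Appendix B §B.1 (6)] [cite: HatcherAT2002, Thm. 3.11] -/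
theorem gysin_map_eq_lefschetzPow_secCl (hS : IsSmoothProjective 2 S) (hX : IsSmoothProjective 3 X) (i : S ⟶ X)
    (x : complexBetti X (2 * 1)) :
    complexGysin complexOrientationFamily hS hX i (by norm_num : 2 * 1 + 2 * 3 = 2 * 2 + 2 * 2)
        ((complexBetti.map i (2 * 1)).hom x) =
      lefschetzPow (SecCl[hS, hX, i]) 1 (2 * 1) x := by
  refine (gysin_map_eq_cup_secCl hS hX i x).trans ?_
  simp only [lefschetzPow_succ, lefschetzPow_zero, LinearMap.comp_apply, LinearMap.id_apply,
    lefschetzOperator_apply]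
  exact cupProduct_comm_two_two ℂ x (SecCl[hS, hX, i])

/-- **RED with `Λ = ⋆_L` (KERNEL): `E₂(X) ⟸ B⋆(X)[σ] ∧ E(S)`** for any surface `i : S ⟶ X` whose class `σ = i_* 1_S` is a
polarisation class of the threefold `X`: André's `⋆_L : H⁴(X) → H²(X)` inverts `L_σ = i_* i^*` on both sides (hard Lefschetz) and is
algebraic by `B⋆(X)[σ]`. [cite: Andre1996Motifs, §0.2 (p. 7) and §1.1 (p. 10)] [cite: Grothendieck1968, §3 p. 196] -/
theorem weightTwoShift_algebraic_of_B_of_surface (hX : IsSmoothProjective 3 X) (hS : IsSmoothProjective 2 S)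
    (i : S ⟶ X) (hσ : IsPolarizationClass 3 X (SecCl[hS, hX, i]))
    (hB : StandardConjectureBStar 3 X (SecCl[hS, hX, i])) (hE : ES[S]) : E2[X] := by
  have hL := hσ.hasHardLefschetz
  refine weightTwoShift_algebraic_of_surface_abstract hX hS i
    (lefschetzInvolution hL (show 2 * 1 + 2 * 1 + 2 * 1 = 2 * 3 by norm_num)) (hB hσ _ _ _)
    (fun x ↦ ?_) (fun y ↦ ?_) hE
  · rw [gysin_map_eq_lefschetzPow_secCl hS hX i x]
    exact lefschetzInvolution_lefschetzPow hL (b := 2 * 1) (j := 1) (by norm_num) _ x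
  · rw [gysin_map_eq_lefschetzPow_secCl hS hX i]
    exact lefschetzPow_lefschetzInvolution hL (b := 2 * 1) (j := 1) (by norm_num) _ y

/-- **André's `⋆_L : Hᵃ → Hᵇ` (`a + b = 2n`) of a polarisation class is a rational Hodge shift of codimension `b`** (bidegree
`(b − n, b − n)`). [cite: Andre1996Motifs, §0.2 (p. 7) and §1.1 (p. 10)] [cite: VoisinHodgeI2002, Thm. 6.25 and §7.1.2] -/
theorem rhShift_lefschetzInvolution (hX : IsSmoothProjective n X) {η : complexBetti X 2}
    (hη : IsPolarizationClass n X η) {a b : ℕ} (hab : a + b = 2 * n) :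
    RHShift[n, n, X, X, a, b, b, lefschetzInvolution hη.hasHardLefschetz hab] := by
  obtain ⟨B⟩ := nonempty_hodgeModel_holds (n := n) (X := X) hX
  have hI := hodgePQ_independent_of_hodgeModel_holds
  refine ⟨fun c hc ↦ isRationalClass_lefschetzInvolution hX hη hab hc,
    fun p q hpq c hc p' q' hp' hq' ↦ ?_, fun p q hpq c hc hlt ↦ ?_⟩
  · exact ⟨B, pullback_lefschetzInvolution_mem_hodgePQ hX hη B hab hpq ((hI.isOfHodgeType_iff hX B).1 hc)
      hp' hq'⟩
  · rw [eq_zero_of_pullback_mem_hodgePQ_of_lt B hpq ((hI.isOfHodgeType_iff hX B).1 hc) (by omega),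
      map_zero]

/-- **The reduction is EXACT (KERNEL): conversely `B⋆(X)[σ] ∧ E₂(X) ⟹` every rational Hodge endomorphism `ψ` of `H²(S)` in the
CORNER `ψ = p ψ p` is algebraic**, where `p := i^* ∘ ⋆_L ∘ i_* ∈ End(H²(S))` is the (algebraic) projector onto `i^*H²(X)` along
the vanishing cohomology `ker i_*`. So `E₂(X)` is exactly the `p`-corner of `E(S)`. [cite: Andre1996Motifs, §2.1 (p. 15)]
[cite: VoisinHodgeII2003, §2.3.3 (2.10) and Cor. 2.25] -/
theorem weightTwoEnd_corner_of_weightTwoShift (hX : IsSmoothProjective 3 X) (hS : IsSmoothProjective 2 S)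
    (i : S ⟶ X) (hσ : IsPolarizationClass 3 X (SecCl[hS, hX, i]))
    (hB : StandardConjectureBStar 3 X (SecCl[hS, hX, i])) (h₂ : E2[X])
    (ψ : complexBetti S (2 * 1) →ₗ[ℂ] complexBetti S (2 * 1))
    (hψ : RHShift[2, 2, S, S, 2 * 1, 2 * 1, 2, ψ])
    (hcorner : ψ =
      ((complexBetti.map i (2 * 1)).hom ∘ₗ
          lefschetzInvolution hσ.hasHardLefschetz (show 2 * 2 + 2 * 1 = 2 * 3 by norm_num) ∘ₗ
          complexGysin complexOrientationFamily hS hX i (by norm_num : 2 * 1 + 2 * 3 = 2 * 2 + 2 * 2)) ∘ₗ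
        ψ ∘ₗ
        ((complexBetti.map i (2 * 1)).hom ∘ₗ
          lefschetzInvolution hσ.hasHardLefschetz (show 2 * 2 + 2 * 1 = 2 * 3 by norm_num) ∘ₗ
          complexGysin complexOrientationFamily hS hX i (by norm_num : 2 * 1 + 2 * 3 = 2 * 2 + 2 * 2))) :
    IsAlgebraicCorrespondence 2 2 S S ψ := by
  set gy := complexGysin complexOrientationFamily hS hX i (by norm_num : 2 * 1 + 2 * 3 = 2 * 2 + 2 * 2)
    with hgy_def
  set pb : complexBetti X (2 * 1) →ₗ[ℂ] complexBetti S (2 * 1) := (complexBetti.map i (2 * 1)).hom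
    with hpb_def
  set Λ := lefschetzInvolution hσ.hasHardLefschetz (show 2 * 2 + 2 * 1 = 2 * 3 by norm_num) with hΛ_def
  have hΛS : RHShift[3, 3, X, X, 2 * 2, 2 * 1, 2 * 1, Λ] := rhShift_lefschetzInvolution hX hσ _
  have hΛA : IsAlgebraicCorrespondence 3 3 X X Λ := hB hσ _ _ _
  have hgyS : RHShift[3, 2, X, S, 2 * 1, 2 * 2, 3, gy] := rhShift_complexGysin hS hX i _ (by norm_num)
  have hpbS : RHShift[2, 3, S, X, 2 * 1, 2 * 1, 3, pb] := rhShift_map hS hX i (2 * 1)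
  have hgyA : IsAlgebraicCorrespondence 3 2 X S gy :=
    isAlgebraicCorrespondence_complexGysin complexOrientationFamily hasPoincareDuality_complexOrientationFamily
      hS hX i _ (q := 2) (by norm_num)
  have hpbA : IsAlgebraicCorrespondence 2 3 S X pb := isAlgebraicCorrespondence_map hS hX i (by norm_num)
  -- the shift `φ := ⋆ i_* ψ i^* ⋆ : H⁴(X) → H²(X)` is a rational Hodge morphism of bidegree `(−1,−1)`
  set φ : complexBetti X (2 * 2) →ₗ[ℂ] complexBetti X (2 * 1) := Λ ∘ₗ (gy ∘ₗ (ψ ∘ₗ (pb ∘ₗ Λ))) with hφ_def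
  have s1 : RHShift[2, 3, S, X, 2 * 2, 2 * 1, 2, (pb ∘ₗ Λ)] := rhShift_comp hS hΛS hpbS (by norm_num) (by norm_num)
  have s2 : RHShift[2, 3, S, X, 2 * 2, 2 * 1, 2, (ψ ∘ₗ (pb ∘ₗ Λ))] := rhShift_comp hS s1 hψ (by norm_num) (by norm_num)
  have s3 : RHShift[3, 3, X, X, 2 * 2, 2 * 2, 3, (gy ∘ₗ (ψ ∘ₗ (pb ∘ₗ Λ)))] :=
    rhShift_comp hX s2 hgyS (by norm_num) (by norm_num)
  have hφS : RHShift[3, 3, X, X, 2 * 2, 2 * 1, 2, φ] := rhShift_comp hX s3 hΛS (by norm_num) (by norm_num)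
  have hφA : IsAlgebraicCorrespondence 3 3 X X φ := h₂ φ hφS
  have key : (pb ∘ₗ Λ ∘ₗ gy) ∘ₗ ψ ∘ₗ (pb ∘ₗ Λ ∘ₗ gy) = pb ∘ₗ (φ ∘ₗ gy) := rfl
  rw [hcorner, key]
  refine IsAlgebraicCorrespondence.comp hS hX hS ?_ hpbA (by norm_num)
  exact IsAlgebraicCorrespondence.comp hX hX hS hgyA hφA (by norm_num)

/-! ## §4 THE MASTER REDUCTION: the square of a threefold is decided in dimension four -/

/-- **`HC22sq(X) ⟸ SQ3Conv ∧ B⋆(X) ∧ E(S) ∧ W1Retr[X] ∧ HC22C[X]`** for any surface `i : S ⟶ X` with `i_* 1_S` a polarisation class: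
the rational `(2,2)`-classes of the SIXFOLD `X × X` are decided by `B(X)`, the Künneth-projector converse, the classical weight-one
retractions, and Hodge `(2,2)`-classes on the FOURFOLDS `S × S` (through `E(S)`), `X × C`, `C × X`.
(statement: cell hodge-nonav ROUTE-P1U row RED/SQ4; reduction, not in print) [cite: Kleiman1968AlgebraicCycles, §2 Thm. 2A11]
[cite: VoisinHodgeI2002, §11.3.3 Lemma 11.41] -/
theorem hodgeTwoTwo_sq_of_B_surface_curves (hconv : SQ3Conv) (hX : IsSmoothProjective 3 X)
    (hS : IsSmoothProjective 2 S) (i : S ⟶ X) (hσ : IsPolarizationClass 3 X (SecCl[hS, hX, i]))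
    (hB : ∀ η : complexBetti X 2, StandardConjectureBStar 3 X η) (hE : ES[S])
    (hR : W1Retr[X]) (h : HC22C[X]) : HC22sq[X] :=
  hconv hX hB (weightTwoShift_algebraic_of_B_of_surface hX hS i hσ (hB _) hE)
    (oddShifts_algebraic_of_hc22TimesCurve hX hR h)

/-- **Fourfold form of the surface input**: `HC22sq(X) ⟸ SQ3Conv ∧ B⋆(X) ∧ HC⁴(S × S)_{(2,2)} ∧ W1Retr[X] ∧ HC22C[X]`.
[cite: Kleiman1968AlgebraicCycles, §2 Thm. 2A11] [cite: VoisinHodgeI2002, §11.3.3 Lemma 11.41] -/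
theorem hodgeTwoTwo_sq_of_B_fourfolds (hconv : SQ3Conv) (hX : IsSmoothProjective 3 X)
    (hS : IsSmoothProjective 2 S) (i : S ⟶ X) (hσ : IsPolarizationClass 3 X (SecCl[hS, hX, i]))
    (hB : ∀ η : complexBetti X 2, StandardConjectureBStar 3 X η)
    (hSS : ∀ c : complexBetti (S ⊗ S) (2 * 2), IsRationalClass c →
      IsOfHodgeType (2 + 2) (S ⊗ S) (2 * 2) 2 2 c → c ∈ algebraicClasses (S ⊗ S) 2)
    (hR : W1Retr[X]) (h : HC22C[X]) : HC22sq[X] :=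
  hodgeTwoTwo_sq_of_B_surface_curves hconv hX hS i hσ hB (weightTwoEnd_algebraic_of_hodgeTwoTwo_sq hS hSS) hR h

/-- **`HC22C[X] ⟸ CH₀(X × C)` and `CH₀(C × X)` supported in dimension `≤ 3` for every curve `C`** (KERNEL: tree Bloch–Srinivas
`mem_algebraicClasses_of_le_two_of_hasChowZeroSupportedInDimLE`) — the UNIRULED case. [cite: BlochSrinivas1983, Thm. 1 (3)]
[cite: VoisinHodgeII2003, Prop. 10.26] -/
theorem hodgeTwoTwo_timesCurve_of_chowZero (hX : IsSmoothProjective 3 X)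
    (hW : ∀ ⦃C : SchemeOver ℂ⦄, IsSmoothProjective 1 C →
      HasChowZeroSupportedInDimLE (X ⊗ C) 3 ∧ HasChowZeroSupportedInDimLE (C ⊗ X) 3) :
    HC22C[X] := fun C hC ↦ by
  obtain ⟨h1, h2⟩ := hW hC
  exact ⟨fun c hc hH ↦ mem_algebraicClasses_of_le_two_of_hasChowZeroSupportedInDimLE (hX.tensor_holds hC)
      le_rfl h1 2 le_rfl c hc hH,
    fun c hc hH ↦ mem_algebraicClasses_of_le_two_of_hasChowZeroSupportedInDimLE (hC.tensor_holds hX)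
      le_rfl h2 2 le_rfl c hc hH⟩

/-- **Uniruled-type corollary**: `HC22sq(X) ⟸ SQ3Conv ∧ B⋆(X) ∧ E(S) ∧ W1Retr[X] ∧ [CH₀(X × C), CH₀(C × X) supported in dim ≤ 3
for all curves C]`. [cite: BlochSrinivas1983, Thm. 1 (3)] [cite: Kleiman1968AlgebraicCycles, §2 Thm. 2A11] -/
theorem hodgeTwoTwo_sq_of_B_surface_chowZero (hconv : SQ3Conv) (hX : IsSmoothProjective 3 X)
    (hS : IsSmoothProjective 2 S) (i : S ⟶ X) (hσ : IsPolarizationClass 3 X (SecCl[hS, hX, i]))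
    (hB : ∀ η : complexBetti X 2, StandardConjectureBStar 3 X η) (hE : ES[S]) (hR : W1Retr[X])
    (hW : ∀ ⦃C : SchemeOver ℂ⦄, IsSmoothProjective 1 C →
      HasChowZeroSupportedInDimLE (X ⊗ C) 3 ∧ HasChowZeroSupportedInDimLE (C ⊗ X) 3) : HC22sq[X] :=
  hodgeTwoTwo_sq_of_B_surface_curves hconv hX hS i hσ hB hE hR (hodgeTwoTwo_timesCurve_of_chowZero hX hW)

/-- The same with Tankeev's named fact discharging `B⋆(X)` off general type (`κ(X) < 3`). [cite: Tankeev2011, main theorem] -/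
theorem hodgeTwoTwo_sq_of_tankeev_surface_chowZero (hconv : SQ3Conv)
    (hT : Tankeev2011_lefschetzStandard_threefold_kodairaDim_lt_three) (hX : IsSmoothProjective 3 X)
    (hκ : ¬ Motives.IsOfGeneralType 3 X) (hS : IsSmoothProjective 2 S) (i : S ⟶ X)
    (hσ : IsPolarizationClass 3 X (SecCl[hS, hX, i])) (hE : ES[S]) (hR : W1Retr[X])
    (hW : ∀ ⦃C : SchemeOver ℂ⦄, IsSmoothProjective 1 C →
      HasChowZeroSupportedInDimLE (X ⊗ C) 3 ∧ HasChowZeroSupportedInDimLE (C ⊗ X) 3) : HC22sq[X] :=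
  hodgeTwoTwo_sq_of_B_surface_chowZero hconv hX hS i hσ (hT hX hκ) hE hR hW

end Summit.HodgeConjecture.HodgeConjecture.Theorems.ThreefoldSquare

end
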